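import Summits.CriticalPhenomena.CardyFormulaZ2.Theorems.CardyComplexConeParafermionToSLESixFamiliesDiamondDartPhaseCalib
import Summits.CriticalPhenomena.CardyFormulaZ2.Theorems.CardyComplexConeParafermionToSLESixFamiliesDiamondTraceStart
import HarnessLib

/-!
# The counter-clockwise staircase path from the `B`-end of the start edge
# (line `potential-darboux-picard-diamond`, S1p `stub_boundaryDartPhase`, part 16)

Crux `ParafermionToSLESixFamilies` (stmt-CriticalPhenomena-11389), line `potential-darboux-picard-diamond`, stub
`stub_boundaryDartPhase` (S1p). For an admissible datum on a lattice box (`X_j ≤ M j`, S1c) the `B`-end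
`b₀ = x₀ + u_{k₀}` of the start edge lies on the two layers of a side `k` or, at a corner of the box, on those of the
previous side `k + 3` below the layers of side `k`; in all cases there is a lattice path `P 0 = b₀, …, P L` of OUT-EDGES
without repeated site, ending on the two layers of side `k` at any prescribed tangential coordinate `T⋆` ahead (up to two
units before the end of the side), of length at most `T⋆ - T_k(b₀)` plus the number of layers of side `k` below `b₀`
(`exists_outPath`, registered): the staircase of side `k` from `b₀` (from `x₀` if `b₀` is on the outer layer: then the start
edge is the step `u_k` of the staircase, `startDir_of_outer`), preceded at a corner by the end of the staircase of side
`k + 3` up to the first inner site of side `k`. With `forall_mem_zdArcB_of_outPath` every site of the path is on `B`.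
-/

noncomputable section

namespace Summit.CriticalPhenomena.CardyFormulaZ2.Cruxes.ParafermionToSLESixFamilies.PotentialDarbouxPicardDiamond

open Set Metric Complex
open Literature.Probability Literature.Probability.LatticeModels Literature.Probability.Percolation
open Literature.Probability.LatticeModels.DiscreteDobrushin
open Literature.Probability.RandomPlanarGeometry

/-- The tangential coordinate along the staircase. -/
theorem T_stair (k : Fin 4) (x : Site 2) (n : ℤ) : xiC k (stair k x n) + upC k (stair k x n) = xiC k x + upC k x + n := by
  simp only [xiC_stair, upC_stair]; omega

/-- The layer coordinate along the staircase. -/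
theorem X_stair (k : Fin 4) (x : Site 2) (n : ℤ) : xiC k (stair k x n) - upC k (stair k x n) = xiC k x - upC k x + n % 2 := by
  simp only [xiC_stair, upC_stair]; omega

/-- The first step of the staircase. -/
theorem stair_one (k : Fin 4) (x : Site 2) : stair k x 1 = x + cornerUnit k := by
  have := stair_succ k x 0
  rw [zero_add, stair_zero, Int.zero_emod, if_pos rfl] at this
  exact this

section Box

variable {Ω : Set ℂ} (hconv : Convex ℝ Ω) {δ : ℝ} (hgood : ∀ x : Site 2, meshPoint δ x ∈ Ω → x ∈ meshDomain Ω δ)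
  {E : DiscreteDobrushin} (hΩ : E.Ω = Ω) (hEδ : E.δ = δ) {M : Fin 4 → ℤ}
  (hbox : ∀ x : Site 2, meshPoint δ x ∈ Ω ↔ ∀ j : Fin 4, xiC j x - upC j x ≤ M j)

include hΩ hEδ hbox in
/-- **The start edge at an outer-layer `B`-end is the staircase step `u_k`**: if `b₀ = x₀ + u_{k₀}` lies on the outer
layer `X_k = M k` of side `k` then `k₀ = k` (the inner face of the start edge has its four corners in the box). -/
theorem startDir_of_outer (hE : E.IsZdAdmissible) (k : Fin 4)
    (hX : xiC k ((startCorner hE).1 + cornerUnit (startCorner hE).2) - upC k ((startCorner hE).1 + cornerUnit (startCorner hE).2) = M k) :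
    (startCorner hE).2 = k := by
  have hsc := isStartCorner_startCorner hE
  have hinner := hsc.isOutEdge.1
  have hin : ∀ v : Site 2, IsCorner v (faceAt (startCorner hE).1 (startCorner hE).2) → ∀ j : Fin 4, xiC j v - upC j v ≤ M j := by
    intro v hv
    have := corner_mem_of_isInnerFace hinner hv
    rw [hΩ, hEδ, hbox] at this
    exact this
  have h0 := hin _ (isCorner_faceAt _ _) k
  have h3 : IsCorner ((startCorner hE).1 + cornerUnit (startCorner hE).2 + cornerUnit ((startCorner hE).2 + 1))
      (faceAt (startCorner hE).1 (startCorner hE).2) := by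
    rw [← faceAt_add_unit_succ]
    exact (isCorner_add_faceAt_iff _ _ _).2 (Or.inl rfl)
  have h3' := hin _ h3 k
  obtain ⟨m, hm⟩ := exists_eq_add k (startCorner hE).2
  rw [hm] at hX h3'
  set x := (startCorner hE).1
  fin_cases m
  · simpa using hm
  · exfalso
    simp only [Fin.mk_one, xiC_add_unit1, upC_add_unit1] at hX
    omega
  · exfalso
    simp only [Fin.reduceFinMk, xiC_add_unit2, upC_add_unit2] at hX
    omega
  · exfalso
    simp only [Fin.reduceFinMk, fin4_add_three_add_one, xiC_add_unit3, upC_add_unit3, xiC_add_unit0, upC_add_unit0] at hX h3'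
    omega

include hconv hgood hΩ hEδ hbox in
/-- **The staircase of side `k` from the `B`-end of the start edge**, when `b₀` is on the two layers of side `k`: an
out-edge path `P 0 = b₀, …, P L` reaching the tangential coordinate `T⋆`. -/
theorem exists_outPath_side (hE : E.IsZdAdmissible) (k : Fin 4)
    (hXb : M k - 1 ≤ xiC k ((startCorner hE).1 + cornerUnit (startCorner hE).2) - upC k ((startCorner hE).1 + cornerUnit (startCorner hE).2))
    (hw : 2 ≤ M k + M (k + 2)) (Ts : ℤ)
    (hTs1 : xiC k ((startCorner hE).1 + cornerUnit (startCorner hE).2) + upC k ((startCorner hE).1 + cornerUnit (startCorner hE).2) ≤ Ts)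
    (hTs2 : Ts + 2 ≤ M (k + 1)) :
    ∃ (P : ℕ → Site 2) (L : ℕ), P 0 = (startCorner hE).1 + cornerUnit (startCorner hE).2 ∧
      (∀ i : ℕ, i < L → ∃ d : Fin 4, P (i + 1) = P i + cornerUnit d ∧ E.IsOutEdge (P i) d) ∧
      (∀ i j : ℕ, i ≤ L → j ≤ L → P i = P j → i = j) ∧
      M k - 1 ≤ xiC k (P L) - upC k (P L) ∧ xiC k (P L) + upC k (P L) = Ts ∧
      (L : ℤ) = Ts - (xiC k ((startCorner hE).1 + cornerUnit (startCorner hE).2) + upC k ((startCorner hE).1 + cornerUnit (startCorner hE).2)) := by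
  have hsc := isStartCorner_startCorner hE
  set x₀ := (startCorner hE).1 with hx₀
  set b₀ := (startCorner hE).1 + cornerUnit (startCorner hE).2 with hb₀
  have hb₀in : ∀ j : Fin 4, xiC j b₀ - upC j b₀ ≤ M j := by
    have := mem_of_mem_zdBoundary (E.zdArcB_subset_zdBoundary hsc.mem_zdArcB)
    rw [hΩ, hEδ, hbox] at this; exact this
  obtain ⟨hXb', hTb', -, hTb0⟩ := (box_iff_side M k b₀).1 hb₀in
  -- the inner start of the staircase and the index of `b₀` on it
  obtain ⟨x', n₀, hX', hT', hn₀, hstart, hx'T⟩ : ∃ (x' : Site 2) (n₀ : ℤ), xiC k x' - upC k x' = M k - 1 ∧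
      xiC k x' + upC k x' + n₀ = xiC k b₀ + upC k b₀ ∧ (n₀ = 0 ∨ n₀ = 1) ∧ stair k x' n₀ = b₀ ∧ -M (k + 3) ≤ xiC k x' + upC k x' := by
    rcases (show xiC k b₀ - upC k b₀ = M k - 1 ∨ xiC k b₀ - upC k b₀ = M k by omega) with h | h
    · exact ⟨b₀, 0, h, by simp, Or.inl rfl, stair_zero k b₀, hTb0⟩
    · have hk := startDir_of_outer hΩ hEδ hbox hE k h
      have hx₀in : ∀ j : Fin 4, xiC j x₀ - upC j x₀ ≤ M j := by
        have := mem_of_mem_zdBoundary (E.zdArcA_subset_zdBoundary hsc.mem_zdArcA)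
        rw [hΩ, hEδ, hbox] at this; exact this
      obtain ⟨-, -, -, hTx0⟩ := (box_iff_side M k x₀).1 hx₀in
      have hb : b₀ = x₀ + cornerUnit k := by rw [hb₀, hk]
      refine ⟨x₀, 1, ?_, ?_, Or.inr rfl, ?_, hTx0⟩
      · rw [hb, xiC_add_unit0, upC_add_unit0] at h; omega
      · rw [hb, xiC_add_unit0, upC_add_unit0]; ring
      · rw [hb, stair_one]
  obtain ⟨L, hL⟩ : ∃ L : ℕ, (L : ℤ) = Ts - (xiC k b₀ + upC k b₀) := ⟨(Ts - (xiC k b₀ + upC k b₀)).toNat, by omega⟩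
  refine ⟨fun i => stair k x' (n₀ + i), L, ?_, ?_, ?_, ?_, ?_, hL⟩
  · show stair k x' (n₀ + ((0 : ℕ) : ℤ)) = b₀
    rw [Nat.cast_zero, add_zero, hstart]
  · intro i hi
    have h1 : -M (k + 3) + (n₀ + i) % 2 ≤ xiC k x' + upC k x' + (n₀ + i) := by omega
    have h2 : xiC k x' + upC k x' + (n₀ + i) + 2 - (n₀ + i) % 2 ≤ M (k + 1) := by omega
    obtain ⟨hout, hstep⟩ := stair_outEdge hconv hgood hΩ hEδ hbox k hX' hw h1 h2
    refine ⟨_, ?_, hout⟩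
    show stair k x' (n₀ + ((i + 1 : ℕ) : ℤ)) = _
    rw [← hstep]; congr 1; push_cast; ring
  · intro i j _ _ h
    have := stair_injective k x' h; omega
  · show M k - 1 ≤ xiC k (stair k x' (n₀ + L)) - upC k (stair k x' (n₀ + L))
    rw [X_stair]; omega
  · show xiC k (stair k x' (n₀ + L)) + upC k (stair k x' (n₀ + L)) = Ts
    rw [T_stair]; omega

include hconv hgood hΩ hEδ hbox in
/-- **The staircase path from the `B`-end of the start edge at a corner of the box**: `b₀` on the two layers of side
`k + 3` below the layers of side `k`; the end of the staircase of side `k + 3` up to the first inner site `J` of side `k`,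
then the staircase of side `k` from `J`. -/
theorem exists_outPath_corner (hE : E.IsZdAdmissible) (k : Fin 4)
    (hXb : xiC k ((startCorner hE).1 + cornerUnit (startCorner hE).2) - upC k ((startCorner hE).1 + cornerUnit (startCorner hE).2) ≤ M k - 2)
    (hXb' : M (k + 3) - 1 ≤ xiC (k + 3) ((startCorner hE).1 + cornerUnit (startCorner hE).2) - upC (k + 3) ((startCorner hE).1 + cornerUnit (startCorner hE).2))
    (hXlow : -M (k + 2) + 3 ≤ xiC k ((startCorner hE).1 + cornerUnit (startCorner hE).2) - upC k ((startCorner hE).1 + cornerUnit (startCorner hE).2))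
    (hw : 2 ≤ M k + M (k + 2)) (hw' : 2 ≤ M (k + 3) + M (k + 1)) (Ts : ℤ)
    (hTs1 : xiC k ((startCorner hE).1 + cornerUnit (startCorner hE).2) + upC k ((startCorner hE).1 + cornerUnit (startCorner hE).2) + 1 ≤ Ts)
    (hTs2 : Ts + 2 ≤ M (k + 1)) :
    ∃ (P : ℕ → Site 2) (L : ℕ), P 0 = (startCorner hE).1 + cornerUnit (startCorner hE).2 ∧
      (∀ i : ℕ, i < L → ∃ d : Fin 4, P (i + 1) = P i + cornerUnit d ∧ E.IsOutEdge (P i) d) ∧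
      (∀ i j : ℕ, i ≤ L → j ≤ L → P i = P j → i = j) ∧
      M k - 1 ≤ xiC k (P L) - upC k (P L) ∧ xiC k (P L) + upC k (P L) = Ts ∧
      (L : ℤ) ≤ Ts - (xiC k ((startCorner hE).1 + cornerUnit (startCorner hE).2) + upC k ((startCorner hE).1 + cornerUnit (startCorner hE).2)) +
        (M k - 1 - (xiC k ((startCorner hE).1 + cornerUnit (startCorner hE).2) - upC k ((startCorner hE).1 + cornerUnit (startCorner hE).2))) + 1 := by
  have hsc := isStartCorner_startCorner hE
  -- index arithmetic on `Fin 4` and the frame of side `k + 3`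
  have e31 : k + 3 + 1 = k := fin4_add_three_add_one k
  have e32 : k + 3 + 2 = k + 1 := by fin_cases k <;> rfl
  have e33 : k + 3 + 3 = k + 2 := fin4_add_three_add_three k
  have hXT : ∀ v : Site 2, xiC k v - upC k v = xiC (k + 3) v + upC (k + 3) v := fun v => by
    have := X_succ (k + 3) v; rwa [e31] at this
  have hTX : ∀ v : Site 2, xiC k v + upC k v = -(xiC (k + 3) v - upC (k + 3) v) := fun v => by
    have := X_add_three k v; linarith
  set x₀ := (startCorner hE).1 with hx₀
  set b₀ := (startCorner hE).1 + cornerUnit (startCorner hE).2 with hb₀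
  have hb₀in : ∀ j : Fin 4, xiC j b₀ - upC j b₀ ≤ M j := by
    have := mem_of_mem_zdBoundary (E.zdArcB_subset_zdBoundary hsc.mem_zdArcB)
    rw [hΩ, hEδ, hbox] at this; exact this
  have hXb3 := hb₀in (k + 3)
  obtain ⟨-, -, -, hTb0⟩ := (box_iff_side M k b₀).1 hb₀in
  -- the inner start of the staircase of side `k + 3` and the index of `b₀` on it
  obtain ⟨x', n₀, hX', hT', hn₀, hstart⟩ : ∃ (x' : Site 2) (n₀ : ℤ), xiC (k + 3) x' - upC (k + 3) x' = M (k + 3) - 1 ∧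
      xiC (k + 3) x' + upC (k + 3) x' + n₀ = xiC (k + 3) b₀ + upC (k + 3) b₀ ∧ (n₀ = 0 ∨ n₀ = 1) ∧ stair (k + 3) x' n₀ = b₀ := by
    rcases (show xiC (k + 3) b₀ - upC (k + 3) b₀ = M (k + 3) - 1 ∨ xiC (k + 3) b₀ - upC (k + 3) b₀ = M (k + 3) by omega) with h | h
    · exact ⟨b₀, 0, h, by simp, Or.inl rfl, stair_zero _ b₀⟩
    · have hk := startDir_of_outer hΩ hEδ hbox hE (k + 3) h
      have hb : b₀ = x₀ + cornerUnit (k + 3) := by rw [hb₀, hk]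
      refine ⟨x₀, 1, ?_, ?_, Or.inr rfl, ?_⟩
      · rw [hb, xiC_add_unit0, upC_add_unit0] at h; omega
      · rw [hb, xiC_add_unit0, upC_add_unit0]; ring
      · rw [hb, stair_one]
  have hT'b : xiC (k + 3) b₀ + upC (k + 3) b₀ = xiC k b₀ - upC k b₀ := (hXT b₀).symm
  -- the first piece and the junction
  obtain ⟨nJ, hnJ⟩ : ∃ nJ : ℕ, (nJ : ℤ) = M k - 1 - (xiC k b₀ - upC k b₀) := ⟨(M k - 1 - (xiC k b₀ - upC k b₀)).toNat, by omega⟩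
  set Q : ℕ → Site 2 := fun i => stair (k + 3) x' (n₀ + i) with hQ
  have hQT : ∀ i : ℕ, xiC k (Q i) - upC k (Q i) = xiC k b₀ - upC k b₀ + i := fun i => by
    rw [hXT, hQ]; simp only [T_stair]; omega
  have hQstep : ∀ i : ℕ, i < nJ → ∃ d : Fin 4, Q (i + 1) = Q i + cornerUnit d ∧ E.IsOutEdge (Q i) d := by
    intro i hi
    have h1 : -M (k + 3 + 3) + (n₀ + i) % 2 ≤ xiC (k + 3) x' + upC (k + 3) x' + (n₀ + i) := by rw [e33]; omega
    have h2 : xiC (k + 3) x' + upC (k + 3) x' + (n₀ + i) + 2 - (n₀ + i) % 2 ≤ M (k + 3 + 1) := by rw [e31]; omega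
    have hw3 : 2 ≤ M (k + 3) + M (k + 3 + 2) := by rw [e32]; exact hw'
    obtain ⟨hout, hstep⟩ := stair_outEdge hconv hgood hΩ hEδ hbox (k + 3) hX' hw3 h1 h2
    refine ⟨_, ?_, hout⟩
    show stair (k + 3) x' (n₀ + ((i + 1 : ℕ) : ℤ)) = _
    rw [← hstep]; congr 1; push_cast; ring
  set J : Site 2 := Q nJ with hJ
  have hJX : xiC k J - upC k J = M k - 1 := by rw [hJ, hQT]; omega
  have hXJ' : xiC (k + 3) J - upC (k + 3) J = M (k + 3) - 1 + (n₀ + nJ) % 2 := by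
    rw [hJ, hQ]; simp only [X_stair]; omega
  have hJT : -M (k + 3) ≤ xiC k J + upC k J ∧ xiC k J + upC k J ≤ -M (k + 3) + 1 := by
    have := hTX J; omega
  have hTb : xiC k b₀ + upC k b₀ ≤ -M (k + 3) + 1 := by have := hTX b₀; omega
  -- the second piece
  obtain ⟨L₂, hL₂⟩ : ∃ L₂ : ℕ, (L₂ : ℤ) = Ts - (xiC k J + upC k J) := ⟨(Ts - (xiC k J + upC k J)).toNat, by omega⟩
  set R : ℕ → Site 2 := fun m => stair k J m with hR
  have hRstep : ∀ m : ℕ, m < L₂ → ∃ d : Fin 4, R (m + 1) = R m + cornerUnit d ∧ E.IsOutEdge (R m) d := by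
    intro m hm
    have h1 : -M (k + 3) + (m : ℤ) % 2 ≤ xiC k J + upC k J + m := by omega
    have h2 : xiC k J + upC k J + m + 2 - (m : ℤ) % 2 ≤ M (k + 1) := by omega
    obtain ⟨hout, hstep⟩ := stair_outEdge hconv hgood hΩ hEδ hbox k hJX hw h1 h2
    refine ⟨_, ?_, hout⟩
    show stair k J ((m + 1 : ℕ) : ℤ) = _
    rw [← hstep]; push_cast; rfl
  have hR0 : R 0 = J := by simp [hR]
  have ne_QR : ∀ i m : ℕ, i ≤ nJ → 1 ≤ m → Q i ≠ R m := by
    intro i m hi hm h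
    rcases Nat.lt_or_ge i nJ with hlt | hge
    · have h1 : xiC k (Q i) - upC k (Q i) = xiC k (R m) - upC k (R m) := by rw [h]
      have hXR : xiC k (R m) - upC k (R m) = M k - 1 + (m : ℤ) % 2 := by rw [hR]; simp only [X_stair]; omega
      rw [hQT, hXR] at h1
      omega
    · have hi' : i = nJ := le_antisymm hi hge
      rw [hi', ← hJ, ← hR0, hR] at h
      have := stair_injective k J h
      omega
  -- the concatenation
  refine ⟨fun i => if i ≤ nJ then Q i else R (i - nJ), nJ + L₂, ?_, ?_, ?_, ?_⟩
  · show (if 0 ≤ nJ then Q 0 else R (0 - nJ)) = b₀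
    rw [if_pos (Nat.zero_le _), hQ]
    simp only [Nat.cast_zero, add_zero, hstart]
  · intro i hi
    rcases lt_trichotomy (i + 1) (nJ + 1) with h | h | h
    · -- inside the first piece
      obtain ⟨d, hd, hout⟩ := hQstep i (by omega)
      refine ⟨d, ?_, ?_⟩
      · simp only [show i + 1 ≤ nJ from by omega, show i ≤ nJ from by omega, ↓reduceIte, hd]
      · simp only [show i ≤ nJ from by omega, ↓reduceIte]; exact hout
    · -- at the junction
      have hi' : i = nJ := by omega
      subst hi'
      obtain ⟨d, hd, hout⟩ := hRstep 0 (by omega)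
      refine ⟨d, ?_, ?_⟩
      · simp only [show ¬ (i + 1 ≤ i) from by omega, le_refl, ↓reduceIte, Nat.add_sub_cancel_left]
        rw [hd, hR0]
      · simp only [le_refl, ↓reduceIte]; rw [← hJ, ← hR0]; exact hout
    · -- inside the second piece
      obtain ⟨d, hd, hout⟩ := hRstep (i - nJ) (by omega)
      refine ⟨d, ?_, ?_⟩
      · simp only [show ¬ (i + 1 ≤ nJ) from by omega, show ¬ (i ≤ nJ) from by omega, ↓reduceIte]
        rw [show i + 1 - nJ = i - nJ + 1 by omega, hd]
      · simp only [show ¬ (i ≤ nJ) from by omega, ↓reduceIte]; exact hout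
  · intro i j hi hj h
    by_cases hi' : i ≤ nJ <;> by_cases hj' : j ≤ nJ <;> simp only [hi', hj', ↓reduceIte] at h
    · have := stair_injective (k + 3) x' h; omega
    · exact absurd h (ne_QR i (j - nJ) hi' (by omega))
    · exact absurd h.symm (ne_QR j (i - nJ) hj' (by omega))
    · have := stair_injective k J h; omega
  · have hPL : (if nJ + L₂ ≤ nJ then Q (nJ + L₂) else R (nJ + L₂ - nJ)) = R L₂ := by
      by_cases h0 : L₂ = 0
      · subst h0; simp [hR0, hJ]
      · rw [if_neg (by omega), Nat.add_sub_cancel_left]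
    show M k - 1 ≤ xiC k (if nJ + L₂ ≤ nJ then Q (nJ + L₂) else R (nJ + L₂ - nJ)) - upC k (if nJ + L₂ ≤ nJ then Q (nJ + L₂) else R (nJ + L₂ - nJ)) ∧
      xiC k (if nJ + L₂ ≤ nJ then Q (nJ + L₂) else R (nJ + L₂ - nJ)) + upC k (if nJ + L₂ ≤ nJ then Q (nJ + L₂) else R (nJ + L₂ - nJ)) = Ts ∧
      ((nJ + L₂ : ℕ) : ℤ) ≤ Ts - (xiC k b₀ + upC k b₀) + (M k - 1 - (xiC k b₀ - upC k b₀)) + 1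
    rw [hPL]
    refine ⟨?_, ?_, ?_⟩
    · rw [hR]; simp only [X_stair]; omega
    · rw [hR]; simp only [T_stair]; omega
    · push_cast; omega
end Box

/-- **The counter-clockwise staircase path from the `B`-end of the start edge** (registered helper of
`stub_boundaryDartPhase`). See the module docstring. -/
theorem exists_outPath : ∀ (Ω : Set ℂ), Convex ℝ Ω → ∀ (δ : ℝ), (∀ x : Site 2, meshPoint δ x ∈ Ω → x ∈ meshDomain Ω δ) → ∀ (E : DiscreteDobrushin), E.Ω = Ω → E.δ = δ → ∀ (M : Fin 4 → ℤ), (∀ x : Site 2, meshPoint δ x ∈ Ω ↔ ∀ j : Fin 4, xiC j x - upC j x ≤ M j) → ∀ (hE : E.IsZdAdmissible) (k : Fin 4), (M k - 1 ≤ xiC k ((startCorner hE).1 + cornerUnit (startCorner hE).2) - upC k ((startCorner hE).1 + cornerUnit (startCorner hE).2) ∨ M (k + 3) - 1 ≤ xiC (k + 3) ((startCorner hE).1 + cornerUnit (startCorner hE).2) - upC (k + 3) ((startCorner hE).1 + cornerUnit (startCorner hE).2)) → -M (k + 2) + 3 ≤ xiC k ((startCorner hE).1 + cornerUnit (startCorner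 hE).2) - upC k ((startCorner hE).1 + cornerUnit (startCorner hE).2) → 2 ≤ M k + M (k + 2) → 2 ≤ M (k + 3) + M (k + 1) → ∀ (Ts : ℤ), xiC k ((startCorner hE).1 + cornerUnit (startCorner hE).2) + upC k ((startCorner hE).1 + cornerUnit (startCorner hE).2) + 1 ≤ Ts → Ts + 2 ≤ M (k + 1) → ∃ (P : ℕ → Site 2) (L : ℕ), P 0 = (startCorner hE).1 + cornerUnit (startCorner hE).2 ∧ (∀ i : ℕ, i < L → ∃ d : Fin 4, P (i + 1) = P i + cornerUnit d ∧ E.IsOutEdge (P i) d) ∧ (∀ i j : ℕ, i ≤ L → j ≤ L → P i = P j → i = j) ∧ M k - 1 ≤ xiC k (P L) - upC k (P L) ∧ xiC k (P L) + upC k (P L) = Ts ∧ (L : ℤ) ≤ Ts - (xiC k ((startCorner hE).1 + cornerUnit (startCorner hE).2) + upC k ((startCorner hE).1 + cornerUnit (startCorner hE).2)) + max 0 (M k - 1 - (xiC k ((startCorner hE).1 + cornerUnit (startCorner hE).2) - upC k ((startCorner hE).1 + cornerUnit (startCorner hE).2))) + 1 := by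
  intro Ω hconv δ hgood E hΩ hEδ M hbox hE k hlayers hXlow hw hw' Ts hTs1 hTs2
  by_cases hX : M k - 1 ≤ xiC k ((startCorner hE).1 + cornerUnit (startCorner hE).2) - upC k ((startCorner hE).1 + cornerUnit (startCorner hE).2)
  · obtain ⟨P, L, h0, h1, h2, h3, h4, h5⟩ := exists_outPath_side hconv hgood hΩ hEδ hbox hE k hX hw Ts (by omega) hTs2
    exact ⟨P, L, h0, h1, h2, h3, h4, by have := le_max_left 0 (M k - 1 - (xiC k ((startCorner hE).1 + cornerUnit (startCorner hE).2) - upC k ((startCorner hE).1 + cornerUnit (startCorner hE).2))); omega⟩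
  · have hX' := hlayers.resolve_left hX
    obtain ⟨P, L, h0, h1, h2, h3, h4, h5⟩ := exists_outPath_corner hconv hgood hΩ hEδ hbox hE k (by omega) hX' hXlow hw hw' Ts hTs1 hTs2
    exact ⟨P, L, h0, h1, h2, h3, h4, by have := le_max_right 0 (M k - 1 - (xiC k ((startCorner hE).1 + cornerUnit (startCorner hE).2) - upC k ((startCorner hE).1 + cornerUnit (startCorner hE).2))); omega⟩

end Summit.CriticalPhenomena.CardyFormulaZ2.Cruxes.ParafermionToSLESixFamilies.PotentialDarbouxPicardDiamond

end
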